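import Mathlib
import Summits.AtomisticToContinuum.Crystallization.Theses.ReggeStarCoercivity
import Literature.MathematicalPhysics.StatisticalMechanics.LennardJonesThermodynamicLimitProofs

/-!
# `EnergyLimitGlue` — the energetic conjunct from star coercivity
(route `ReggeStarCoercivity`, support item `stmt-AtomisticToContinuum-13606`)

`StarCoercivity → CrysEnergyUpper → CrysPeriodicMinAttained →
HasPeriodicGroundStateEnergy lennardJones 3`.

PROOF. Let `P` be the periodic minimiser given by `CrysPeriodicMinAttained` and
`e(P)` its Lennard-Jones energy per particle; `IsLeast.csInf_eq` gives `⨅_Q e(Q) = e(P)`.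
By `BlancLewin2015_8_holds` (Fekete, proved in tree) `E(N)/N → e_∞` for some real `e_∞`.
*Upper half*: `CrysEnergyUpper` is `limsup E(N)/N ≤ ⨅_Q e(Q)`, and the limsup of a convergent
sequence is its limit (`Tendsto.limsup_eq`), so `e_∞ ≤ e(P)`.
*Lower half*: `StarCoercivity` evaluated at a ground state `x^N` (which exists in `d = 3`,
`exists_isGroundState_lennardJones`, is injective and has energy `E(N)`), with the non-negative
defect term `g · #{defective sites}` dropped, gives `N · e(P) − C · N^{2/3} ≤ E(N)`, i.e.
`e(P) − C · N^{2/3}/N ≤ E(N)/N` for `N ≥ 1`; since `N^{2/3}/N = N^{−1/3} → 0`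
(`tendsto_rpow_neg_atTop`), `le_of_tendsto_of_tendsto` gives `e(P) ≤ e_∞`.
Hence `e_∞ = e(P)`, and `⟨P, IsLeast, E(N)/N → e(P)⟩` is `HasPeriodicGroundStateEnergy`.
-/

noncomputable section

namespace Summit.AtomisticToContinuum.Crystallization.Theorems

open Summit.AtomisticToContinuum.Crystallization.Theses
open Literature.MathematicalPhysics.StatisticalMechanics
open Filter Topology

/-- Dropping a non-negative term from the left-hand side of an inequality:
`a + g·k − c ≤ E` with `g, k ≥ 0` gives `a − c ≤ E`. (Used to discard the defect-counting term
of `StarCoercivity`, whose exact shape is irrelevant here.) -/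
theorem energyLimitGlue_drop_nonneg {a g k c E : ℝ} (h : a + g * k - c ≤ E) (hg : 0 ≤ g)
    (hk : 0 ≤ k) : a - c ≤ E := by
  nlinarith [mul_nonneg hg hk]

/-- `N^{2/3}/N → 0` along the naturals (it equals `N^{−1/3}` for `N ≥ 1`). -/
theorem energyLimitGlue_tendsto_rpow_div :
    Tendsto (fun N : ℕ => (N : ℝ) ^ (2 / 3 : ℝ) / N) atTop (𝓝 0) := by
  have h0 : Tendsto (fun N : ℕ => (N : ℝ) ^ (-(1 / 3 : ℝ))) atTop (𝓝 0) :=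
    (tendsto_rpow_neg_atTop (by norm_num : (0 : ℝ) < 1 / 3)).comp tendsto_natCast_atTop_atTop
  refine h0.congr' ?_
  filter_upwards [eventually_gt_atTop 0] with N hN
  have hN' : (0 : ℝ) < N := by exact_mod_cast hN
  rw [← Real.rpow_sub_one hN'.ne']
  norm_num

/-- **`EnergyLimitGlue`** (item `stmt-AtomisticToContinuum-13606` of route `ReggeStarCoercivity`):
star coercivity, the trial-state upper bound `limsup E(N)/N ≤ ⨅_Q e(Q)` and attainment of the
periodic minimum together give the energetic conjunct of crystallization,
`HasPeriodicGroundStateEnergy lennardJones 3`: with `P` the periodic minimiser, `E(N)/N → e(P)`.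
The thermodynamic limit `E(N)/N → e_∞` is `BlancLewin2015_8_holds`; the upper bound gives
`e_∞ ≤ e(P)` and star coercivity at ground states (defect term dropped, error `C·N^{−1/3} → 0`)
gives `e(P) ≤ e_∞`. -/
theorem energyLimitGlue_proof : ReggeStarCoercivity.EnergyLimitGlue := by
  unfold ReggeStarCoercivity.EnergyLimitGlue
  intro hX hUpper hMin
  obtain ⟨P, hP⟩ := hMin
  refine ⟨P, hP, ?_⟩
  -- the periodic infimum is attained at `P`
  have hinf : (⨅ Q : PeriodicConfiguration 3, Q.energyPerParticle lennardJones) =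
      P.energyPerParticle lennardJones := hP.csInf_eq
  -- thermodynamic limit `E(N)/N → e`
  obtain ⟨e, -, hlim, -⟩ := BlancLewin2015_8_holds 3 (by norm_num) (by norm_num)
  -- upper half: `e ≤ e(P)`
  have h_upper : e ≤ P.energyPerParticle lennardJones := by
    have h := hUpper
    unfold ReggeStarCoercivity.CrysEnergyUpper at h
    rwa [hlim.limsup_eq, hinf] at h
  -- lower half: `e(P) ≤ e`
  have h_lower : P.energyPerParticle lennardJones ≤ e := by
    obtain ⟨g, hg, C, hC⟩ := hX
    have hbound : ∀ᶠ N : ℕ in atTop,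
        P.energyPerParticle lennardJones - C * ((N : ℝ) ^ (2 / 3 : ℝ) / N) ≤
          groundStateEnergy lennardJones 3 N / N := by
      filter_upwards [eventually_gt_atTop 0] with N hN
      have hN' : (0 : ℝ) < N := by exact_mod_cast hN
      obtain ⟨x, hx_inj, hx_eq⟩ := exists_isGroundState_lennardJones (by norm_num : 0 < 3) N
      have h := hC N x hx_inj
      rw [hinf, hx_eq] at h
      have key : (N : ℝ) * P.energyPerParticle lennardJones - C * (N : ℝ) ^ (2 / 3 : ℝ) ≤
          groundStateEnergy lennardJones 3 N :=
        energyLimitGlue_drop_nonneg h hg.le (Nat.cast_nonneg _)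
      rw [le_div_iff₀ hN']
      have hmul : (P.energyPerParticle lennardJones - C * ((N : ℝ) ^ (2 / 3 : ℝ) / N)) * N =
          (N : ℝ) * P.energyPerParticle lennardJones - C * (N : ℝ) ^ (2 / 3 : ℝ) := by
        rw [sub_mul, mul_assoc, div_mul_cancel₀ _ hN'.ne', mul_comm]
      rw [hmul]
      exact key
    have htend : Tendsto
        (fun N : ℕ => P.energyPerParticle lennardJones - C * ((N : ℝ) ^ (2 / 3 : ℝ) / N))
        atTop (𝓝 (P.energyPerParticle lennardJones - C * 0)) :=
      tendsto_const_nhds.sub (energyLimitGlue_tendsto_rpow_div.const_mul C)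
    rw [mul_zero, sub_zero] at htend
    exact le_of_tendsto_of_tendsto htend hlim hbound
  -- conclude: `e = e(P)`
  have he : e = P.energyPerParticle lennardJones := le_antisymm h_upper h_lower
  rw [← he]
  exact hlim

end Summit.AtomisticToContinuum.Crystallization.Theorems

end
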